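import Literature.AlgebraicGeometry.AbelianSchemes.CoverSurjectiveOfSerrePresentation   -- ★ LA3-p02 p848547 (surjectivity twin)
import Literature.AlgebraicGeometry.AbelianSchemes.AbelianSchemeOverQuasiInverseIsogeny   -- ★ `isFinite_left_of_quasiInverse`, `flat_left_of_quasiInverse`
import HarnessLib

/-!
# A homomorphism carrying a two-sided Serre presentation clause is FINITE and FLAT

Topic `AlgebraicGeometry/AbelianSchemes`, namespace `Literature.AlgebraicGeometry.AbelianSchemes.AbelianSchemeOver`.  THEOREMS ONLY (no definition, no instance,
no notation, no named fact).  Cell `hodgecm-mathlib` (D-0151), P6 «MOD», line L3 (socket `stub_FROB`, `--supports stmt-HodgeConjecture-24832`, count-neutral): the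
road (δ) glue of `stub_COV0` feeds the GENERIC Serre cover `c` of the spine row `CoverKerΩ` (clause (t1) «`∀ a ∈ 𝔞, ∃ d, c ≫ d = ι_A(a) ∧ d ≫ c = ι_B(a)`») into ★ (ν8)
`exists_specialFibre_hom_reduction`, whose clause (i) asks `IsFinite c.left → Surjective c.left → …`; surjectivity is ★ p848547, finiteness (and flatness) is this file:
at `a := N ∈ 𝔞 ∩ ℕ`, `N ≠ 0`, the clause reads `c ≫ d = ι_A(N) = [N]_A`, `d ≫ c = [N]_B` (★ `RingAction.i_natCast`), i.e. `d` is a quasi-inverse of `c`, and ★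
`isFinite_left_of_quasiInverse` ∕ ★ `flat_left_of_quasiInverse` ([GortzWedhorn2023] Cor. 27.177 (1); [MumfordAV1970] §6 Application 2) apply.

## Source (read at the page)

D. Mumford, *Abelian Varieties* (1970), §6 Application 2 (p. 62) and §7 Thm. 4 (p. 72): `[N]` is an isogeny (finite flat surjective) for `N ≠ 0`, and a homomorphism
through which `[N]` factors on both sides is an isogeny.  U. Görtz–T. Wedhorn, *Algebraic Geometry II* (2023), Cor. 27.177 (1) (fibrewise isogeny ⇒ finite flat).

## Mathlib / tree search

Tree: ★ `AbelianSchemeOverQuasiInverseIsogeny` (`isFinite_left_of_quasiInverse`, `flat_left_of_quasiInverse`, `surjective_left_of_quasiInverse` — quasi-inverse currency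
`φ ≫ ψ = 𝟙 ^ N`), ★ `SerreTensorIsogeny` (`RingAction.i_natCast : ι(N) = 𝟙 ^ N`), ★ p848547 `CoverSurjectiveOfSerrePresentation` (the (t1)-clause currency, surjective).
-/

noncomputable section

universe u

open CategoryTheory CategoryTheory.Limits AlgebraicGeometry
open scoped MonObj

namespace Literature.AlgebraicGeometry.AbelianSchemes

namespace AbelianSchemeOver

variable {S : Scheme.{u}} {A B : AbelianSchemeOver S} {O : Type*} [CommRing O] (actA : A.RingAction O) (act : B.RingAction O)
  (c : A.X ⟶ B.X) [IsMonHom c]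

/-- **`c ≫ d = ι_A(N)`, `d ≫ c = ι_B(N)`, `N ≠ 0` ⇒ `c` finite** (`ι(N) = [N]`, so `d` is a quasi-inverse). [cite: MumfordAV1970, §6 Application 2 (p. 62); §7 Thm. 4 (p. 72)]
[cite: GortzWedhorn2023, Cor. 27.177 (1)] -/
theorem isFinite_left_of_comp_eq_i_natCast (d : B.X ⟶ A.X) {N : ℕ} (hN : N ≠ 0) (hcd : c ≫ d = actA.i (N : O)) (hdc : d ≫ c = act.i (N : O)) :
    IsFinite c.left :=
  isFinite_left_of_quasiInverse c d hN (by rw [hcd, RingAction.i_natCast]) (by rw [hdc, RingAction.i_natCast])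

/-- **`c ≫ d = ι_A(N)`, `d ≫ c = ι_B(N)`, `N ≠ 0` ⇒ `c` flat.** [cite: MumfordAV1970, §6 Application 2 (p. 62); §7 Thm. 4 (p. 72)] [cite: GortzWedhorn2023, Cor. 27.177 (1)] -/
theorem flat_left_of_comp_eq_i_natCast (d : B.X ⟶ A.X) {N : ℕ} (hN : N ≠ 0) (hcd : c ≫ d = actA.i (N : O)) (hdc : d ≫ c = act.i (N : O)) :
    Flat c.left :=
  flat_left_of_quasiInverse c d hN (by rw [hcd, RingAction.i_natCast]) (by rw [hdc, RingAction.i_natCast])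

/-- **THE COVER OF A TWO-SIDED SERRE PRESENTATION IS FINITE**: from «`∀ a ∈ 𝔞, ∃ d, c ≫ d = ι_A(a) ∧ d ≫ c = ι_B(a)`» (P6a `CoverΩ`∕`CoverKerΩ` (t1)) and `N ∈ 𝔞 ∩ ℕ`,
`N ≠ 0` — the `IsFinite c.left` input of ★ (ν8) `exists_specialFibre_hom_reduction` (i). [cite: MumfordAV1970, §6 Application 2 (p. 62); §7 Thm. 4 (p. 72)]
[cite: GortzWedhorn2023, Cor. 27.177 (1)] -/
theorem isFinite_left_of_serrePresentation {𝔞 : Ideal O}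
    (ht1 : ∀ a ∈ 𝔞, ∃ d : B.X ⟶ A.X, c ≫ d = actA.i a ∧ d ≫ c = act.i a) {N : ℕ} (hN : N ≠ 0) (hN𝔞 : (N : O) ∈ 𝔞) :
    IsFinite c.left := by
  obtain ⟨d, hcd, hdc⟩ := ht1 (N : O) hN𝔞
  exact isFinite_left_of_comp_eq_i_natCast actA act c d hN hcd hdc

/-- **… AND FLAT.** [cite: MumfordAV1970, §6 Application 2 (p. 62); §7 Thm. 4 (p. 72)] [cite: GortzWedhorn2023, Cor. 27.177 (1)] -/
theorem flat_left_of_serrePresentation {𝔞 : Ideal O}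
    (ht1 : ∀ a ∈ 𝔞, ∃ d : B.X ⟶ A.X, c ≫ d = actA.i a ∧ d ≫ c = act.i a) {N : ℕ} (hN : N ≠ 0) (hN𝔞 : (N : O) ∈ 𝔞) :
    Flat c.left := by
  obtain ⟨d, hcd, hdc⟩ := ht1 (N : O) hN𝔞
  exact flat_left_of_comp_eq_i_natCast actA act c d hN hcd hdc

end AbelianSchemeOver

end Literature.AlgebraicGeometry.AbelianSchemes

end
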